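import Mathlib.Tactic.Ring
import HarnessLib

/-!
# `NoHeavyLowerTail` (stmt-CriticalPhenomena-4575) — the polarised four-point forms (L1), (L2) at CELL level: definitions

Definitions file (prover prim-l12-p6, cell `prim-l12`, line P6 "stratified / face-first"; `--supports stmt-CriticalPhenomena-4575`).
Pure algebra over a commutative ring; no measure theory, no named facts, no sorries.

SETTING.  The SHK3⁺ terminal-edge step along the apex edge `{a,y}` lives on the 15-cell law of the set partitions of the four
marked points `a,b,c,y` (cell variables `«a|b|c|y»`, …, `«abcy»`, ALWAYS bound in the order of
`CubicThreePointStep.threeB₁_polarization`).  Its two Bernstein pieces are, by the polarization identities (P1′),(P2′) of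
`…CubicThreePointPolarization`, sums of HYBRID Richards–Sahi cubics minus one product; the census-validated open targets are the
measure-level statements `PolarisedRowL1`, `PolarisedRowL2`, `HybridSepRow` of `…GroupSepHybridRows` (P1 line).  This file names
the corresponding CELL-LEVEL homogeneous cubic forms, so that the face-structure theorems of the P6 line
(`…FourPointFaceIdentity`: vanishing on the cut-vertex face, ideal membership, isolated-terminal strata, first-order form off the
face) can be stated readably:

* `E3h σ mA mB mC mAB mAC mBC mABC = 2σ²·mABC + mA·mB·mC − σ(mA·mBC + mB·mAC + mC·mAB)` — the homogenised Richards–Sahi form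
  `E₃` in the masses of three events and their intersections (`σ` = total mass; for a probability law `σ = 1` and this is
  `Literature.Probability.LatticeModels.sahiE3`);  `Hh σ mX mY mXY = σ·mXY − mX·mY` — the homogenised Harris form.
* `hybE₁` = `E3h` of `(D_bc, D_ac, G_ab)`, `hybE₂` = of `(D_bc, G_ac, D_ab)`, `hybE₃g` = of `(D_bc, G_ac, G_ab)`, with
  `D_uv` = "u, v in different blocks", `G_ab = D[ay|b]`, `G_ac = D[ay|c]` (group separations), all masses written as sums of cells;
* `polL₁ = hybE₁ + hybE₂ − σ·«a|bcy»·m(D_bc)`  — the cell form of (L1): `threeB₁ = polL₁ + F(x⁰) + (β₁+β₂)·H(D_ab,D_ac)`;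
* `polL₂ = hybE₃g + hybE₁ + hybE₂ − σ·«a|bcy»·m(G_bc)`, `G_bc = D_bc ∖ {ab|cy, ac|by}` — the cell form of (L2).

Nothing is asserted here.  [cite: GladkovZimin2024HK, §4 (coordinate induction; the forms themselves are this programme's)]
-/

namespace Summit.CriticalPhenomena.PercolationContinuityZ3.Theorems

namespace CubicFourPoint

variable {R : Type*} [CommRing R]

/-- Homogenised Richards–Sahi third-order form in the masses of three events `A,B,C`, their pairwise intersections and their
triple intersection, with total mass `σ`: `2σ²·m(ABC) + m(A)m(B)m(C) − σ·(m(A)m(BC) + m(B)m(AC) + m(C)m(AB))`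
(at `σ = 1` this is Sahi's `E₃(1_A,1_B,1_C)`). [cite: LiebSahi2021, eq. (2.1) (arXiv p. 5)] -/
def E3h (σ mA mB mC mAB mAC mBC mABC : R) : R :=
  2 * σ ^ 2 * mABC + mA * mB * mC - σ * (mA * mBC + mB * mAC + mC * mAB)

/-- Homogenised Harris form of two events: `σ·m(X ∩ Y) − m(X)·m(Y)`. [folklore] -/
def Hh (σ mX mY mXY : R) : R := σ * mXY - mX * mY

/-- **Hybrid row (E1) at cell level**: `E3h` of the events `D_bc = {b≁c}`, `D_ac = {a≁c}`, `G_ab = D[ay|b] = {b≁a, b≁y}` of the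
15-cell four-point law (masses as sums of cells; `σ` = sum of all 15 cells). [this work] -/
def hybE₁ («a|b|c|y» «a|b|cy» «a|by|c» «a|bc|y» «ay|b|c» «ac|b|y» «ab|c|y» «a|bcy» «ay|bc» «ac|by» «acy|b» «ab|cy» «aby|c» «abc|y» «abcy» : R) : R :=
  E3h («a|b|c|y» + «a|b|cy» + «a|by|c» + «a|bc|y» + «ay|b|c» + «ac|b|y» + «ab|c|y» + «a|bcy» + «ay|bc» + «ac|by» + «acy|b» + «ab|cy» + «aby|c» + «abc|y» + «abcy»)
    («a|b|c|y» + «a|b|cy» + «a|by|c» + «ay|b|c» + «ac|b|y» + «ab|c|y» + «ac|by» + «acy|b» + «ab|cy» + «aby|c»)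
    («a|b|c|y» + «a|b|cy» + «a|by|c» + «a|bc|y» + «ay|b|c» + «ab|c|y» + «a|bcy» + «ay|bc» + «ab|cy» + «aby|c»)
    («a|b|c|y» + «a|b|cy» + «a|bc|y» + «ay|b|c» + «ac|b|y» + «ay|bc» + «acy|b»)
    («a|b|c|y» + «a|b|cy» + «a|by|c» + «ay|b|c» + «ab|c|y» + «ab|cy» + «aby|c»)
    («a|b|c|y» + «a|b|cy» + «ay|b|c» + «ac|b|y» + «acy|b»)
    («a|b|c|y» + «a|b|cy» + «a|bc|y» + «ay|b|c» + «ay|bc»)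
    («a|b|c|y» + «a|b|cy» + «ay|b|c»)

/-- **Mirror hybrid row (E2) at cell level**: `E3h` of `D_bc`, `G_ac = D[ay|c] = {c≁a, c≁y}`, `D_ab = {a≁b}`
(the `b ↔ c` image of `hybE₁`). [this work] -/
def hybE₂ («a|b|c|y» «a|b|cy» «a|by|c» «a|bc|y» «ay|b|c» «ac|b|y» «ab|c|y» «a|bcy» «ay|bc» «ac|by» «acy|b» «ab|cy» «aby|c» «abc|y» «abcy» : R) : R :=
  E3h («a|b|c|y» + «a|b|cy» + «a|by|c» + «a|bc|y» + «ay|b|c» + «ac|b|y» + «ab|c|y» + «a|bcy» + «ay|bc» + «ac|by» + «acy|b» + «ab|cy» + «aby|c» + «abc|y» + «abcy»)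
    («a|b|c|y» + «a|b|cy» + «a|by|c» + «ay|b|c» + «ac|b|y» + «ab|c|y» + «ac|by» + «acy|b» + «ab|cy» + «aby|c»)
    («a|b|c|y» + «a|by|c» + «a|bc|y» + «ay|b|c» + «ab|c|y» + «ay|bc» + «aby|c»)
    («a|b|c|y» + «a|b|cy» + «a|by|c» + «a|bc|y» + «ay|b|c» + «ac|b|y» + «a|bcy» + «ay|bc» + «ac|by» + «acy|b»)
    («a|b|c|y» + «a|by|c» + «ay|b|c» + «ab|c|y» + «aby|c»)
    («a|b|c|y» + «a|b|cy» + «a|by|c» + «ay|b|c» + «ac|b|y» + «ac|by» + «acy|b»)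
    («a|b|c|y» + «a|by|c» + «a|bc|y» + «ay|b|c» + «ay|bc»)
    («a|b|c|y» + «a|by|c» + «ay|b|c»)

/-- **Shape-(i) hybrid row at cell level**: `E3h` of `D_bc`, `G_ac = D[ay|c]`, `G_ab = D[ay|b]` (both non-`bc` slots evaluated in
the contracted graph `G/{a,y}`). [this work] -/
def hybE₃g («a|b|c|y» «a|b|cy» «a|by|c» «a|bc|y» «ay|b|c» «ac|b|y» «ab|c|y» «a|bcy» «ay|bc» «ac|by» «acy|b» «ab|cy» «aby|c» «abc|y» «abcy» : R) : R :=
  E3h («a|b|c|y» + «a|b|cy» + «a|by|c» + «a|bc|y» + «ay|b|c» + «ac|b|y» + «ab|c|y» + «a|bcy» + «ay|bc» + «ac|by» + «acy|b» + «ab|cy» + «aby|c» + «abc|y» + «abcy»)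
    («a|b|c|y» + «a|b|cy» + «a|by|c» + «ay|b|c» + «ac|b|y» + «ab|c|y» + «ac|by» + «acy|b» + «ab|cy» + «aby|c»)
    («a|b|c|y» + «a|by|c» + «a|bc|y» + «ay|b|c» + «ab|c|y» + «ay|bc» + «aby|c»)
    («a|b|c|y» + «a|b|cy» + «a|bc|y» + «ay|b|c» + «ac|b|y» + «ay|bc» + «acy|b»)
    («a|b|c|y» + «a|by|c» + «ay|b|c» + «ab|c|y» + «aby|c»)
    («a|b|c|y» + «a|b|cy» + «ay|b|c» + «ac|b|y» + «acy|b»)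
    («a|b|c|y» + «a|bc|y» + «ay|b|c» + «ay|bc»)
    («a|b|c|y» + «ay|b|c»)

/-- **(L1) at cell level**: `polL₁ = hybE₁ + hybE₂ − σ·«a|bcy»·m(D_bc)`, the polarised form of the first Bernstein piece of SHK3⁺
along the apex edge `{a,y}` (`threeB₁ = polL₁ + F(x⁰) + (β₁+β₂)·H(D_ab,D_ac)`, cf. `threeB₁_polarization`).  Its nonnegativity on
every four-point connectivity law of a finite weighted graph is the open target `PolarisedRowL1`. [this work] -/
def polL₁ («a|b|c|y» «a|b|cy» «a|by|c» «a|bc|y» «ay|b|c» «ac|b|y» «ab|c|y» «a|bcy» «ay|bc» «ac|by» «acy|b» «ab|cy» «aby|c» «abc|y» «abcy» : R) : R :=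
  hybE₁ «a|b|c|y» «a|b|cy» «a|by|c» «a|bc|y» «ay|b|c» «ac|b|y» «ab|c|y» «a|bcy» «ay|bc» «ac|by» «acy|b» «ab|cy» «aby|c» «abc|y» «abcy»
    + hybE₂ «a|b|c|y» «a|b|cy» «a|by|c» «a|bc|y» «ay|b|c» «ac|b|y» «ab|c|y» «a|bcy» «ay|bc» «ac|by» «acy|b» «ab|cy» «aby|c» «abc|y» «abcy»
    - («a|b|c|y» + «a|b|cy» + «a|by|c» + «a|bc|y» + «ay|b|c» + «ac|b|y» + «ab|c|y» + «a|bcy» + «ay|bc» + «ac|by» + «acy|b» + «ab|cy» + «aby|c» + «abc|y» + «abcy»)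
        * «a|bcy» * («a|b|c|y» + «a|b|cy» + «a|by|c» + «ay|b|c» + «ac|b|y» + «ab|c|y» + «ac|by» + «acy|b» + «ab|cy» + «aby|c»)

/-- **(L2) at cell level**: `polL₂ = hybE₃g + hybE₁ + hybE₂ − σ·«a|bcy»·m(G_bc)` with `G_bc = D_bc ∖ {ab|cy, ac|by}` ("`b≁c` in the
contracted graph"), the polarised form of the second Bernstein piece (`threeB₂ = polL₂ + (β₁+β₂)·(H(D_ac,G_ab)+H(G_ac,D_ab))`,
cf. `threeB₂_polarization`).  Its nonnegativity on realizable laws is the open target `PolarisedRowL2`. [this work] -/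
def polL₂ («a|b|c|y» «a|b|cy» «a|by|c» «a|bc|y» «ay|b|c» «ac|b|y» «ab|c|y» «a|bcy» «ay|bc» «ac|by» «acy|b» «ab|cy» «aby|c» «abc|y» «abcy» : R) : R :=
  hybE₃g «a|b|c|y» «a|b|cy» «a|by|c» «a|bc|y» «ay|b|c» «ac|b|y» «ab|c|y» «a|bcy» «ay|bc» «ac|by» «acy|b» «ab|cy» «aby|c» «abc|y» «abcy»
    + hybE₁ «a|b|c|y» «a|b|cy» «a|by|c» «a|bc|y» «ay|b|c» «ac|b|y» «ab|c|y» «a|bcy» «ay|bc» «ac|by» «acy|b» «ab|cy» «aby|c» «abc|y» «abcy»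
    + hybE₂ «a|b|c|y» «a|b|cy» «a|by|c» «a|bc|y» «ay|b|c» «ac|b|y» «ab|c|y» «a|bcy» «ay|bc» «ac|by» «acy|b» «ab|cy» «aby|c» «abc|y» «abcy»
    - («a|b|c|y» + «a|b|cy» + «a|by|c» + «a|bc|y» + «ay|b|c» + «ac|b|y» + «ab|c|y» + «a|bcy» + «ay|bc» + «ac|by» + «acy|b» + «ab|cy» + «aby|c» + «abc|y» + «abcy»)
        * «a|bcy» * («a|b|c|y» + «a|b|cy» + «a|by|c» + «ay|b|c» + «ac|b|y» + «ab|c|y» + «acy|b» + «aby|c»)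

end CubicFourPoint

end Summit.CriticalPhenomena.PercolationContinuityZ3.Theorems
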